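import Summits.BirchSwinnertonDyer.Rank1Residual.X1.KellerYinCharTwoVariableDescent
import Summits.BirchSwinnertonDyer.BirchSwinnertonDyer.Theorems.EisensteinPrimesTwoVariableDualModule
import Literature.NumberTheory.EllipticCurves.GreenbergSelmerDualDataExistsProofs
import Literature.NumberTheory.EllipticCurves.IwasawaSelmerProofs
import Literature.NumberTheory.GaloisRepresentations.AbsGaloisGroupCompact
import Mathlib.NumberTheory.Padics.RingHoms
import HarnessLib

/-!
# [E₂] `DualData₂ExistsFor`: the `Λ₂`-dual of `H¹_{nr}(K̃_∞, A)` over the `ℤ_p²`-tower EXISTS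
# (helper file 7 for crux 2 `GoodLatticeBDPValue`, stmt-BirchSwinnertonDyer-19032, cell `bsd-eis` seat `bsd-eis-k5-c2`)

Discharge of the typer's displayed input [E₂] `X1.KellerYinCharTwoVariableDescent.DualData₂ExistsFor`
(k5-ty g3, p439467 §1: "A KERNEL CONSTRUCTION owed (RULING L13 (S2) deferred it)"):
`theorem dualData₂ExistsFor_holds : DualData₂ExistsFor p`.  The algebra is the landed
`exists_module₂` (file `…TwoVariableDualModule`, p447643: two commuting locally nilpotent
endomorphisms ⟹ a `ℤ_p⟦T₂⟧⟦T₁⟧`-structure on the dual); this file supplies the Galois input over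
the `ℤ_p²`-tower `K̃_∞ = K̄^{pairKer κ₁ κ₂}`:

* `exists_apply_eq_of_isTopGeneratorPair` : a generator pair makes `Γ_K → ℤ_p × ℤ_p` SURJECTIVE
  (the image is compact, hence closed, and contains the dense `ℤ²`);
* `exists_openNormalSubgroup_conjH1_pair_eq`, `exists_conjH1_pair_pow_prime_pow_eq` : every class
  of `H¹(K̃_∞, A)` is fixed by an open normal subgroup, hence by `conj_{γ^{p^a}}` for every
  `γ ∈ Γ_K` (the two-generator twins of the tree's (A1), (A2));
* `isLocNil_conjSel₂_sub_one`, `conjSel₂_comm` : `conj_γ − 1` is locally nilpotent on the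
  `p`-primary group `H¹_{nr}(K̃_∞, A)`, and `conj_{γ₁}`, `conj_{γ₂}` commute there (commutators lie in
  `pairKer`, inner automorphisms act trivially);
* `dualData₂ExistsFor_holds`.

HONEST FRAMING: removes the input [E₂] from the two-variable road (MEMO-3 §4 R2); closes nothing by
itself. References: Greenberg, LNM 1716 (1999) §1; Neukirch–Schmidt–Wingberg I §5; Rubin 1991 §4
p. 36.
-/

-- the summit namespace `Summit.BirchSwinnertonDyer.BirchSwinnertonDyer` repeats the problem name by design (D-0017)
set_option linter.dupNamespace false
set_option autoImplicit false

noncomputable section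

open scoped Classical

open NumberField IsDedekindDomain Field Literature.NumberTheory.GaloisRepresentations
  Literature.NumberTheory.EllipticCurves Literature.NumberTheory.EllipticCurves.GreenbergVatsal2000
  Literature.NumberTheory.EllipticCurves.KellerYin2024

namespace Summit.BirchSwinnertonDyer.BirchSwinnertonDyer.Theorems.IwasawaTwoVariable

universe u

/-! ## §1 A generator pair makes `(κ₁, κ₂) : Γ_K → ℤ_p²` surjective -/

section Pair

variable {K : Type u} [Field K] {p : ℕ} [Fact p.Prime]
  {κ₁ κ₂ : ZpExtension K p} {γ₁ γ₂ : absoluteGaloisGroup K}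

/-- **A generator pair makes `Γ_K → ℤ_p × ℤ_p` surjective**: the image is a compact, hence closed,
subgroup containing `(m, n) = image of γ₁^m γ₂^n` for all integers, and `ℤ²` is dense in `ℤ_p²`.
[folklore] -/
theorem exists_apply_eq_of_isTopGeneratorPair (h : ZpExtension.IsTopGeneratorPair κ₁ κ₂ γ₁ γ₂)
    (a b : ℤ_[p]) :
    ∃ g : absoluteGaloisGroup K, κ₁ g = Multiplicative.ofAdd a ∧ κ₂ g = Multiplicative.ofAdd b := by
  haveI : CompactSpace (absoluteGaloisGroup K) := absoluteGaloisGroup_compactSpace K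
  let F : absoluteGaloisGroup K → ℤ_[p] × ℤ_[p] := fun g =>
    (Multiplicative.toAdd (κ₁ g), Multiplicative.toAdd (κ₂ g))
  have hF : Continuous F :=
    (continuous_toAdd.comp (map_continuous κ₁)).prodMk (continuous_toAdd.comp (map_continuous κ₂))
  have hclosed : IsClosed (Set.range F) := (isCompact_range hF).isClosed
  have h1 : Multiplicative.toAdd (κ₁ γ₁) = 1 := by rw [show κ₁ γ₁ = _ from h.left, toAdd_ofAdd]
  have h2 : Multiplicative.toAdd (κ₂ γ₂) = 1 := by rw [show κ₂ γ₂ = _ from h.right, toAdd_ofAdd]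
  have h12 : Multiplicative.toAdd (κ₂ γ₁) = 0 := by rw [h.apply_left, toAdd_one]
  have h21 : Multiplicative.toAdd (κ₁ γ₂) = 0 := by rw [h.apply_right, toAdd_one]
  have hsub : Set.range (Prod.map (Int.cast : ℤ → ℤ_[p]) (Int.cast : ℤ → ℤ_[p])) ⊆ Set.range F := by
    rintro _ ⟨⟨m, n⟩, rfl⟩
    refine ⟨γ₁ ^ m * γ₂ ^ n, ?_⟩
    simp only [F, map_mul, map_zpow, toAdd_mul, toAdd_zpow, h1, h2, h12, h21, Prod.map_apply,
      smul_zero, add_zero, zero_add, zsmul_eq_mul, mul_one]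
  have hdense : Dense (Set.range F) :=
    ((PadicInt.denseRange_intCast (p := p)).prodMap (PadicInt.denseRange_intCast (p := p))).mono
      hsub
  have huniv : Set.range F = Set.univ := by rw [← hdense.closure_eq, hclosed.closure_eq]
  obtain ⟨g, hg⟩ : (a, b) ∈ Set.range F := huniv ▸ Set.mem_univ _
  refine ⟨g, ?_, ?_⟩
  · apply Multiplicative.toAdd.injective
    rw [toAdd_ofAdd]
    exact congrArg Prod.fst hg
  · apply Multiplicative.toAdd.injective
    rw [toAdd_ofAdd]
    exact congrArg Prod.snd hg

/-- `pairKer κ₁ κ₂` is closed in `Γ_K`. [folklore] -/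
theorem isClosed_pairKer (κ₁ κ₂ : ZpExtension K p) :
    IsClosed ((ZpExtension.pairKer κ₁ κ₂ : Subgroup (absoluteGaloisGroup K)) :
      Set (absoluteGaloisGroup K)) := by
  rw [ZpExtension.pairKer, Subgroup.coe_inf]
  exact κ₁.isClosed_kerSubgroup.inter κ₂.isClosed_kerSubgroup

/-- `Gal(K̄/K̃_∞) = pairKer κ₁ κ₂` is compact. [folklore] -/
theorem compactSpace_pairKer (κ₁ κ₂ : ZpExtension K p) :
    CompactSpace (ZpExtension.pairKer κ₁ κ₂) :=
  haveI : CompactSpace (absoluteGaloisGroup K) := absoluteGaloisGroup_compactSpace K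
  isCompact_iff_compactSpace.mp (isClosed_pairKer κ₁ κ₂).isCompact

end Pair

/-! ## §2 (P), (A1), (A2) over the `ℤ_p²`-tower -/

section Tower

variable {K : Type u} [Field K] [NumberField K] {p : ℕ} [Fact p.Prime]
  (κ₁ κ₂ : ZpExtension K p)
  (M : Type u) [AddCommGroup M] [DistribMulAction (absoluteGaloisGroup K) M] [TopologicalSpace M]
  [DiscreteTopology M]

omit [NumberField K] in
/-- **(P)₂** Every class of `H¹(K̃_∞, A)` is killed by a power of `p` for `A` `p`-primary.
[folklore] -/
theorem exists_pow_smul_subgroupH1_pair_eq_zero (htor : ∀ m : M, ∃ k : ℕ, p ^ k • m = 0)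
    (c : subgroupH1 (ZpExtension.pairKer κ₁ κ₂) M) : ∃ k : ℕ, p ^ k • c = 0 := by
  haveI := compactSpace_pairKer κ₁ κ₂
  obtain ⟨φ, rfl⟩ := oneCocycleClass_surjective _ c
  exact IwasawaDual.exists_pow_smul_oneCocycleClass_eq_zero φ fun σ ↦ htor (φ.1 σ)

omit [NumberField K] in
/-- **(A1)₂** Every class of `H¹(K̃_∞, A)` is fixed by `conj_τ` for all `τ` in some open normal
subgroup of `Γ_K` (points of `A` with open stabilisers) — verbatim the tree's (A1)
`GreenbergSelmer.exists_openNormalSubgroup_conjH1_eq` with `ker κ` replaced by `pairKer κ₁ κ₂`.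
[folklore] -/
theorem exists_openNormalSubgroup_conjH1_pair_eq
    (hstab : ∀ m : M,
      IsOpen (MulAction.stabilizer (absoluteGaloisGroup K) m : Set (absoluteGaloisGroup K)))
    (c : subgroupH1 (ZpExtension.pairKer κ₁ κ₂) M) :
    ∃ Nrm : OpenNormalSubgroup (absoluteGaloisGroup K),
      ∀ τ ∈ Nrm, conjH1 (ZpExtension.pairKer κ₁ κ₂) M τ c = c := by
  haveI := compactSpace_pairKer κ₁ κ₂
  haveI : CompactSpace (absoluteGaloisGroup K) := absoluteGaloisGroup_compactSpace K
  obtain ⟨φ, rfl⟩ := oneCocycleClass_surjective _ c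
  have hfin : (Set.range φ.1).Finite := (isCompact_range φ.1.continuous).finite_of_discrete
  set Ufix : Set (absoluteGaloisGroup K) :=
    {τ | ∀ m ∈ Set.range φ.1, τ • m = m} with hUfix_def
  have hUfix : IsOpen Ufix := by
    have e : Ufix = ⋂ m ∈ Set.range φ.1,
        (MulAction.stabilizer (absoluteGaloisGroup K) m : Set (absoluteGaloisGroup K)) := by
      ext τ
      simp only [hUfix_def, Set.mem_setOf_eq, Set.mem_iInter, SetLike.mem_coe,
        MulAction.mem_stabilizer_iff]
    rw [e]
    exact hfin.isOpen_biInter fun m _ ↦ hstab m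
  have hz : IsOpen {h : ZpExtension.pairKer κ₁ κ₂ | φ.1 h = 0} :=
    (isOpen_discrete ({0} : Set M)).preimage φ.1.continuous
  obtain ⟨U0, hU0, hU0eq⟩ := isOpen_induced_iff.mp hz
  have h1fix : (1 : absoluteGaloisGroup K) ∈ Ufix := fun m _ ↦ one_smul _ m
  have h1U0 : (1 : absoluteGaloisGroup K) ∈ U0 := by
    have : (1 : ZpExtension.pairKer κ₁ κ₂) ∈ Subtype.val ⁻¹' U0 := by
      rw [hU0eq]
      exact contOneCocycles.apply_one φ
    exact this
  obtain ⟨Nrm, hNrm⟩ := ProfiniteGrp.exist_openNormalSubgroup_sub_open_nhds_of_one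
    (hUfix.inter hU0) ⟨h1fix, h1U0⟩
  refine ⟨Nrm, fun τ hτ ↦ IwasawaDual.conjH1_oneCocycleClass_eq φ (fun h ↦ ?_) (fun h n hn ↦ ?_)⟩
  · exact (hNrm hτ).1 _ ⟨h, rfl⟩
  · have hnN : (n : absoluteGaloisGroup K) ∈ Nrm := by
      rw [hn]
      have h1 : (h : absoluteGaloisGroup K)⁻¹ * τ⁻¹ * (h : absoluteGaloisGroup K)⁻¹⁻¹ ∈
          Nrm.toSubgroup :=
        Subgroup.Normal.conj_mem inferInstance _ (Nrm.toSubgroup.inv_mem hτ) _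
      rw [inv_inv] at h1
      exact Nrm.toSubgroup.mul_mem h1 hτ
    have hn0 : n ∈ Subtype.val ⁻¹' U0 := (hNrm hnN).2
    rw [hU0eq] at hn0
    exact hn0

variable {κ₁ κ₂}

/-- **(A2)₂** For a generator pair and ANY `γ ∈ Γ_K`, every class of `H¹(K̃_∞, A)` is fixed by
`conj_{γ^{p^a}}` for some `a`: with `Nrm` as in (A1)₂ of index `d = p^a e`, `p ∤ e`, pick `g₀` with
`(κ₁, κ₂)(g₀) = e⁻¹ · (κ₁, κ₂)(γ)` (§1); then `g₀^d ∈ Nrm`, `(g₀^d)⁻¹ γ^{p^a} ∈ pairKer`, and both act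
trivially. [folklore] -/
theorem exists_conjH1_pair_pow_prime_pow_eq {γ₁ γ₂ : absoluteGaloisGroup K}
    (hγ : ZpExtension.IsTopGeneratorPair κ₁ κ₂ γ₁ γ₂)
    (hstab : ∀ m : M,
      IsOpen (MulAction.stabilizer (absoluteGaloisGroup K) m : Set (absoluteGaloisGroup K)))
    (γ : absoluteGaloisGroup K) (c : subgroupH1 (ZpExtension.pairKer κ₁ κ₂) M) :
    ∃ a : ℕ, conjH1 (ZpExtension.pairKer κ₁ κ₂) M (γ ^ p ^ a) c = c := by
  obtain ⟨Nrm, hNrm⟩ := exists_openNormalSubgroup_conjH1_pair_eq κ₁ κ₂ M hstab c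
  haveI : Finite (absoluteGaloisGroup K ⧸ Nrm.toSubgroup) :=
    Subgroup.quotient_finite_of_isOpen _ Nrm.isOpen
  have hd : Nrm.toSubgroup.index ≠ 0 := Subgroup.index_ne_zero_of_finite
  obtain ⟨a, e, he, hde⟩ := Nat.exists_eq_pow_mul_and_not_dvd hd p (Fact.out : p.Prime).ne_one
  obtain ⟨u, hu⟩ := IwasawaDual.isUnit_natCast_padicInt (p := p) he
  obtain ⟨g₀, hg₁, hg₂⟩ := exists_apply_eq_of_isTopGeneratorPair hγ
    (((u⁻¹ : ℤ_[p]ˣ) : ℤ_[p]) * Multiplicative.toAdd (κ₁ γ))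
    (((u⁻¹ : ℤ_[p]ˣ) : ℤ_[p]) * Multiplicative.toAdd (κ₂ γ))
  have hτN : g₀ ^ Nrm.toSubgroup.index ∈ Nrm := Nrm.toSubgroup.pow_index_mem g₀
  have hκ₁τ : Multiplicative.toAdd (κ₁ (g₀ ^ Nrm.toSubgroup.index)) =
      (p : ℤ_[p]) ^ a * Multiplicative.toAdd (κ₁ γ) := by
    rw [map_pow, hg₁, ← ofAdd_nsmul, toAdd_ofAdd, nsmul_eq_mul, hde, Nat.cast_mul, Nat.cast_pow,
      ← hu, ← mul_assoc, mul_assoc (_ ^ a), Units.mul_inv, mul_one]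
  have hκ₂τ : Multiplicative.toAdd (κ₂ (g₀ ^ Nrm.toSubgroup.index)) =
      (p : ℤ_[p]) ^ a * Multiplicative.toAdd (κ₂ γ) := by
    rw [map_pow, hg₂, ← ofAdd_nsmul, toAdd_ofAdd, nsmul_eq_mul, hde, Nat.cast_mul, Nat.cast_pow,
      ← hu, ← mul_assoc, mul_assoc (_ ^ a), Units.mul_inv, mul_one]
  have hκ₁γ : Multiplicative.toAdd (κ₁ (γ ^ p ^ a)) = (p : ℤ_[p]) ^ a * Multiplicative.toAdd (κ₁ γ) := by
    rw [map_pow, toAdd_pow, nsmul_eq_mul, Nat.cast_pow]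
  have hκ₂γ : Multiplicative.toAdd (κ₂ (γ ^ p ^ a)) = (p : ℤ_[p]) ^ a * Multiplicative.toAdd (κ₂ γ) := by
    rw [map_pow, toAdd_pow, nsmul_eq_mul, Nat.cast_pow]
  have hh₀ : (g₀ ^ Nrm.toSubgroup.index)⁻¹ * γ ^ p ^ a ∈ ZpExtension.pairKer κ₁ κ₂ := by
    rw [ZpExtension.mem_pairKer_iff, map_mul, map_inv, map_mul, map_inv]
    constructor
    · apply Multiplicative.toAdd.injective
      rw [toAdd_mul, toAdd_inv, hκ₁τ, hκ₁γ, toAdd_one, neg_add_cancel]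
    · apply Multiplicative.toAdd.injective
      rw [toAdd_mul, toAdd_inv, hκ₂τ, hκ₂γ, toAdd_one, neg_add_cancel]
  refine ⟨a, ?_⟩
  conv_lhs => rw [← mul_inv_cancel_left (g₀ ^ Nrm.toSubgroup.index) (γ ^ p ^ a)]
  rw [conjH1_mul_holds (ZpExtension.pairKer κ₁ κ₂) M, AddMonoidHom.comp_apply,
    conjH1_of_mem_holds (ZpExtension.pairKer κ₁ κ₂) M hh₀, AddMonoidHom.id_apply]
  exact hNrm _ hτN

variable (vbar : HeightOneSpectrum (𝓞 K))

/-- Powers: `(conjSel₂ γ)^m = conj_{γ^m}` on `H¹_{nr}(K̃_∞, A)`. [folklore] -/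
theorem coe_conjSel₂_pow_apply (γ : absoluteGaloisGroup K) (m : ℕ) (s : unrSelmer₂ κ₁ κ₂ M vbar) :
    ((((conjSel₂ κ₁ κ₂ M vbar γ) ^ m) s : unrSelmer₂ κ₁ κ₂ M vbar) :
        subgroupH1 (ZpExtension.pairKer κ₁ κ₂) M) =
      conjH1 (ZpExtension.pairKer κ₁ κ₂) M (γ ^ m) s := by
  induction m generalizing s with
  | zero => rw [pow_zero, pow_zero, AddMonoid.End.one_apply,
      conjH1_one_holds (ZpExtension.pairKer κ₁ κ₂) M, AddMonoidHom.id_apply]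
  | succ m ih =>
    rw [pow_succ, AddMonoid.End.coe_mul, Function.comp_apply, ih, coe_conjSel₂_apply, pow_succ,
      conjH1_mul_holds (ZpExtension.pairKer κ₁ κ₂) M, AddMonoidHom.comp_apply]

/-- **`conj_γ − 1` is locally nilpotent on `H¹_{nr}(K̃_∞, A)` and the group is `p`-primary**, for `A`
`p`-primary with open stabilisers, a generator pair and ANY `γ ∈ Γ_K` (Greenberg LNM 1716 §1 in
two variables). [folklore] -/
theorem isLocNil_conjSel₂_sub_one {γ₁ γ₂ : absoluteGaloisGroup K}
    (hγ : ZpExtension.IsTopGeneratorPair κ₁ κ₂ γ₁ γ₂)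
    (htor : ∀ m : M, ∃ k : ℕ, p ^ k • m = 0)
    (hstab : ∀ m : M,
      IsOpen (MulAction.stabilizer (absoluteGaloisGroup K) m : Set (absoluteGaloisGroup K)))
    (γ : absoluteGaloisGroup K) :
    IwasawaDual.IsLocNil p (conjSel₂ κ₁ κ₂ M vbar γ - 1) := by
  have htor' : ∀ s : unrSelmer₂ κ₁ κ₂ M vbar, ∃ k : ℕ, p ^ k • s = 0 := fun s ↦ by
    obtain ⟨k, hk⟩ := exists_pow_smul_subgroupH1_pair_eq_zero κ₁ κ₂ M htor
      (s : subgroupH1 (ZpExtension.pairKer κ₁ κ₂) M)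
    exact ⟨k, Subtype.ext (by rw [AddSubgroupClass.coe_nsmul]; exact hk)⟩
  refine ⟨htor', fun s ↦ ?_⟩
  obtain ⟨a, ha⟩ := exists_conjH1_pair_pow_prime_pow_eq M hγ hstab γ
    (s : subgroupH1 (ZpExtension.pairKer κ₁ κ₂) M)
  obtain ⟨k, hk⟩ := htor' s
  have hφ : ((conjSel₂ κ₁ κ₂ M vbar γ) ^ p ^ a) s = s :=
    Subtype.ext (by rw [coe_conjSel₂_pow_apply]; exact ha)
  exact ⟨k * p ^ a, IwasawaDual.pow_mul_prime_pow_apply_eq_zero (Fact.out : p.Prime) _ a hφ hk⟩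

/-- **`conj_γ` and `conj_{γ'}` commute on `H¹_{nr}(K̃_∞, A)`** for all `γ, γ' ∈ Γ_K`:
`Γ_K/pairKer ↪ ℤ_p²` is abelian, so the commutator lies in `pairKer`, which acts trivially on
`H¹(pairKer, ·)` (inner automorphisms). [folklore] -/
theorem conjSel₂_comm (γ γ' : absoluteGaloisGroup K) :
    conjSel₂ κ₁ κ₂ M vbar γ * conjSel₂ κ₁ κ₂ M vbar γ' =
      conjSel₂ κ₁ κ₂ M vbar γ' * conjSel₂ κ₁ κ₂ M vbar γ := by
  have hmem : γ * γ' * (γ' * γ)⁻¹ ∈ ZpExtension.pairKer κ₁ κ₂ := by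
    rw [ZpExtension.mem_pairKer_iff]
    constructor
    · rw [map_mul, map_mul, map_inv, map_mul, mul_comm (κ₁ γ') (κ₁ γ), mul_inv_cancel]
    · rw [map_mul, map_mul, map_inv, map_mul, mul_comm (κ₂ γ') (κ₂ γ), mul_inv_cancel]
  have key : conjH1 (ZpExtension.pairKer κ₁ κ₂) M (γ * γ') =
      conjH1 (ZpExtension.pairKer κ₁ κ₂) M (γ' * γ) := by
    have e : γ * γ' = (γ * γ' * (γ' * γ)⁻¹) * (γ' * γ) := (inv_mul_cancel_right _ _).symm
    rw [e, conjH1_mul_holds (ZpExtension.pairKer κ₁ κ₂) M,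
      conjH1_of_mem_holds (ZpExtension.pairKer κ₁ κ₂) M hmem, AddMonoidHom.id_comp]
  apply AddMonoidHom.ext
  intro s
  apply Subtype.ext
  change ((conjSel₂ κ₁ κ₂ M vbar γ (conjSel₂ κ₁ κ₂ M vbar γ' s) : unrSelmer₂ κ₁ κ₂ M vbar) :
      subgroupH1 (ZpExtension.pairKer κ₁ κ₂) M) =
    ((conjSel₂ κ₁ κ₂ M vbar γ' (conjSel₂ κ₁ κ₂ M vbar γ s) : unrSelmer₂ κ₁ κ₂ M vbar) :
      subgroupH1 (ZpExtension.pairKer κ₁ κ₂) M)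
  rw [coe_conjSel₂_apply, coe_conjSel₂_apply, coe_conjSel₂_apply, coe_conjSel₂_apply,
    ← AddMonoidHom.comp_apply, ← conjH1_mul_holds (ZpExtension.pairKer κ₁ κ₂) M, key,
    conjH1_mul_holds (ZpExtension.pairKer κ₁ κ₂) M, AddMonoidHom.comp_apply]

end Tower

/-! ## §3 [E₂] discharged -/

section Exists

variable (p : ℕ) [Fact p.Prime]

/-- **[E₂] holds: the `Λ₂ = ℤ_p⟦T₁,T₂⟧`-dual datum of `H¹_{nr}(K̃_∞, (F/𝓞)(θ))` EXISTS** for every pair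
of `ℤ_p`-quotients with a generator pair, every character `θ : Γ_K → GL₁(ℤ_p)` and every `v̄`
(`X1.KellerYinCharTwoVariableDescent.DualData₂ExistsFor p`, k5-ty p439467 §1 — "a KERNEL
CONSTRUCTION owed"): the Pontryagin dual `Hom(H¹_{nr}, ℚ/ℤ)` with the structure of
`exists_module₂` for the commuting locally nilpotent `conj_{γ₁} − 1`, `conj_{γ₂} − 1`, `toDual = id`.
[folklore] -/
theorem dualData₂ExistsFor_holds :
    Summit.BirchSwinnertonDyer.Rank1Residual.X1.KellerYinCharTwoVariableDescent.DualData₂ExistsFor p := by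
  intro K _ _ κ₁ κ₂ γ₁ γ₂ hγ θ vbar
  have htor : ∀ m : charModule (∅ : Set (PadicAlgCl p)) θ, ∃ k : ℕ, p ^ k • m = 0 :=
    GreenbergSelmer.exists_pow_smul_cofree_eq_zero (p := p) (∅ : Set (PadicAlgCl p)) θ
  have hstab : ∀ m : charModule (∅ : Set (PadicAlgCl p)) θ,
      IsOpen (MulAction.stabilizer (absoluteGaloisGroup K) m : Set (absoluteGaloisGroup K)) :=
    GreenbergSelmer.isOpen_stabilizer_cofree (p := p) (∅ : Set (PadicAlgCl p)) θ
  have h₁ := isLocNil_conjSel₂_sub_one (charModule (∅ : Set (PadicAlgCl p)) θ) vbar hγ htor hstab γ₁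
  have h₂ := isLocNil_conjSel₂_sub_one (charModule (∅ : Set (PadicAlgCl p)) θ) vbar hγ htor hstab γ₂
  have hab := conjSel₂_comm (κ₁ := κ₁) (κ₂ := κ₂) (charModule (∅ : Set (PadicAlgCl p)) θ) vbar γ₁ γ₂
  have hc := Commute.sub_left (Commute.sub_right hab (Commute.one_right _)) (Commute.one_left _)
  obtain ⟨inst, hX, hCX, hCC⟩ := exists_module₂ h₁ h₂ hc.eq (AddCircle (1 : ℚ))
  refine ⟨{ X := unrSelmer₂ κ₁ κ₂ (charModule (∅ : Set (PadicAlgCl p)) θ) vbar →+ AddCircle (1 : ℚ)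
            module := inst
            toDual := AddMonoidHom.id _
            bijective := Function.bijective_id
            toDual_T₁_smul := fun x s ↦ ?_
            toDual_T₂_smul := fun x s ↦ ?_
            toDual_C_smul := fun c x s k hk ↦ ?_ }⟩
  · show ((PowerSeries.X : PowerSeries (PowerSeries ℤ_[p])) • x) s = x _ - x s
    rw [hX, IwasawaDual.End_sub_apply, AddMonoid.End.one_apply, map_sub]
  · show ((PowerSeries.C (PowerSeries.X : PowerSeries ℤ_[p]) : PowerSeries (PowerSeries ℤ_[p])) •
        x) s = x _ - x s
    rw [hCX, IwasawaDual.End_sub_apply, AddMonoid.End.one_apply, map_sub]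
  · show ((PowerSeries.C (PowerSeries.C c : PowerSeries ℤ_[p]) : PowerSeries (PowerSeries ℤ_[p])) •
        x) s = _
    exact hCC c x s k hk

end Exists


end Summit.BirchSwinnertonDyer.BirchSwinnertonDyer.Theorems.IwasawaTwoVariable

end
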